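import Summits.AnomalousDissipation.AnomalousDissipation.Theorems.BaireTransferDenseLoudDesignerForcesStubTrajectoryPowerBudget
import Literature.Analysis.FluidPDE.EnergySpaceTorusProofs

/-!
# Entry S of the line `ergodic-budget-selection-closing` (crux `BaireTransfer.DenseLoudDesignerForces`, stmt-AnomalousDissipation-1143):
# a loud hyperbolic STEADY STATE lies in the residual set (trajectory form)

Sorry-free discharge of the registered entry `entry_steadyState` of skeleton v9 (fourth lead c3-0, 2026-08-16).  The residual of the line
(Stub 1′ `stub_denseLoudHyperbolicTrajectories`) asks, at every level `j`, for a dense set of forces `c` admitting at some `ν < 1/(j+1)` an NS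
phase `(K, φ)` with ONE LOUD TRAJECTORY `x` (`T⁻¹∫₀ᵀ‖φ_t x‖² ≤ E` eventually, `T⁻¹∫₀ᵀν‖∇φ_t x‖² ≥ ε` frequently) such that every LOUD invariant
probability measure carried by the orbit closure of `x` is hyperbolic.  The DEGENERATE instance is a loud hyperbolic steady state: for a
steady classical solution `v` of NS_ν(f_c) with `∫‖v‖² ≤ E`, `ν‖∇v‖₂² ≥ ε` and hyperbolic linearisation (in the classical form of
`IsHyperbolicMeasure` at the state of `v`: every sub-exponentially growing linearised solution decays exponentially — the flow direction
vanishes), the force `c` belongs to the residual set at every level `j` with `ν < 1/(j+1)`: `K = {[v]}`, `φ_t = id`, the orbit closure is the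
point, its only invariant probability measure is the Dirac mass, whose hyperbolicity is the hypothesis.  This certifies that the residual is
served by the steady loud states of the sibling route `CoherentStates` (and is not vacuous in its structure); it says nothing about density.

References: Foias–Manley–Rosa–Temam 2001 Ch. IV Rem. after Def. 1.2 (Dirac measures at steady states are stationary statistical solutions).
-/

set_option linter.dupNamespace false

noncomputable section

open scoped BigOperators Topology ENNReal InnerProductSpace
open Filter Set Function MeasureTheory

namespace Summit.AnomalousDissipation.AnomalousDissipation.Theorems.DenseLoudDesignerForces.Ergodic

open Literature.Analysis.FunctionSpaces Literature.Analysis.FunctionSpaces.Torus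
open Literature.Analysis.FluidPDE Literature.Analysis.FluidPDE.Torus
open Summit.AnomalousDissipation.AnomalousDissipation.Theses.BaireTransfer
open Summit.AnomalousDissipation.AnomalousDissipation.Theorems.DenseLoudDesignerForces.Negative

section SteadyEntry

variable {ν : ℝ} {F : (UnitAddTorus (Fin 3)) → (EuclideanSpace ℝ (Fin 3))}

/-- **The state of a smooth solenoidal mean-zero field**: its `L²` class lies in the energy space `H`. [folklore] -/
theorem toLp_mem_energySpace {v : (UnitAddTorus (Fin 3)) → (EuclideanSpace ℝ (Fin 3))} (hs : IsSmooth v) (hdiv : IsDivFree v)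
    (hmean : HasZeroMean v) : (hs.memLp 2).toLp v ∈ energySpace (Fin 3) :=
  smoothSolenoidal_subset_energySpace ⟨v, hs, hdiv, hmean, (hs.memLp 2).coeFn_toLp⟩

/-- **The trivial NS phase of a steady state.**  For a steady classical solution `v` (pressure `π`) of NS_ν(F) on `[0,∞)`, the singleton
`{[v]}` with the identity semiflow is an NS phase. [folklore] -/
theorem isNSPhase_singleton_of_steady {v : (UnitAddTorus (Fin 3)) → (EuclideanSpace ℝ (Fin 3))} {π : (UnitAddTorus (Fin 3)) → ℝ}
    (hsol : IsClassicalNSSolutionOn (Ici 0) ν (fun _ => F) (fun _ => v) (fun _ => π)) (hdiv : IsDivFree v) (hmean : HasZeroMean v)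
    (hs : IsSmooth v) :
    IsNSPhase ν F {(⟨(hs.memLp 2).toLp v, toLp_mem_energySpace hs hdiv hmean⟩ : Hsp)} (fun _ y => y) := by
  set x₀ : Hsp := ⟨(hs.memLp 2).toLp v, toLp_mem_energySpace hs hdiv hmean⟩ with hx₀
  have hrep : rep x₀ =ᵐ[volume] v := (hs.memLp 2).coeFn_toLp
  refine
    { isCompact := isCompact_singleton
      mapsTo := fun t _ y hy => hy
      map_zero := fun y _ => rfl
      map_add := fun s t _ _ y _ => rfl
      continuousOn := continuous_snd.continuousOn
      enstrophy_finite := fun y hy => ?_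
      enstrophy_continuousOn := (subsingleton_singleton (a := x₀)).continuousOn _
      trajectory := fun y hy => ?_ }
  · rw [mem_singleton_iff.1 hy, Literature.Analysis.FluidPDE.eGradNormSq_congr_ae hrep]
    exact (eGradNormSq_lt_top hs).ne
  · rw [mem_singleton_iff.1 hy]
    exact ⟨fun _ => v, fun _ => π, hsol, fun t _ => hrep⟩

/-- An invariant probability measure carried by a singleton is concentrated at the point: `x = x₀` a.e. [folklore] -/
theorem ae_eq_of_isInvariantMeasure_singleton {x₀ : Hsp} {φ : ℝ → Hsp → Hsp} {μ : Measure Hsp}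
    (hμ : IsInvariantMeasure {x₀} φ μ) : ∀ᵐ x ∂μ, x = x₀ :=
  (IsInvariantMeasure.ae_mem hμ).mono fun _ hx => mem_singleton_iff.1 hx

/-- **Entry S of the line `ergodic-budget-selection-closing`: a LOUD HYPERBOLIC STEADY STATE lies in the residual set.**  If `v` (pressure
`π`) is a steady classical solution of NS_ν(f_c), mean-zero, with `∫‖v‖² ≤ E`, `ν‖∇v‖₂² ≥ ε`, at a level `j` with `0 < ν < 1/(j+1)`, whose
linearisation is hyperbolic in the classical form of `IsHyperbolicMeasure` at the state of `v` (hypothesis `hH`, the integrand of that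
predicate for the identity semiflow at `[v]`), then `c` belongs to the set of Stub 1′ at level `j` — with `K = {[v]}`, `φ_t = id`, the loud
trajectory `x = [v]`, whose orbit closure `{[v]}` carries only the Dirac mass. [folklore] -/
theorem entry_steadyState {S : Finset (Fin 3 → ℤ)} {c : ↥S → (EuclideanSpace ℂ (Fin 3))} {j : ℕ} {ν : ℝ}
    (hν : 0 < ν) (hνj : ν < 1 / ((j : ℝ) + 1))
    {v : (UnitAddTorus (Fin 3)) → (EuclideanSpace ℝ (Fin 3))} {π : (UnitAddTorus (Fin 3)) → ℝ}
    (hsol : IsClassicalNSSolutionOn (Ici 0) ν (fun _ => force S c) (fun _ => v) (fun _ => π)) (hmean : HasZeroMean v)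
    {E ε : ℝ} (hE : ∫ y, ‖v y‖ ^ 2 ≤ E) (hε : ε ≤ ν * gradNormSq v)
    (hH : ∀ (u : ℝ → (UnitAddTorus (Fin 3)) → (EuclideanSpace ℝ (Fin 3))) (p : ℝ → (UnitAddTorus (Fin 3)) → ℝ),
      IsClassicalNSSolutionOn (Ici 0) ν (fun _ => force S c) u p → (∀ t : ℝ, 0 ≤ t → v =ᵐ[volume] u t) →
      ∀ (w : ℝ → (UnitAddTorus (Fin 3)) → (EuclideanSpace ℝ (Fin 3))) (q : ℝ → (UnitAddTorus (Fin 3)) → ℝ),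
        IsLinearizedNSSolutionOn (Ici 0) ν u w q → SubExpGrowth w →
        ∃ a : ℝ, ∀ (w' : ℝ → (UnitAddTorus (Fin 3)) → (EuclideanSpace ℝ (Fin 3))) (q' : ℝ → (UnitAddTorus (Fin 3)) → ℝ),
          IsLinearizedNSSolutionOn (Ici 0) ν u w' q' → w' 0 = w 0 - a • Torus.timeDerivWithin (Ici 0) u 0 → ExpDecay w') :
    ∃ ν' : ℝ, 0 < ν' ∧ ν' < 1 / ((j : ℝ) + 1) ∧
      ∃ (K : Set Hsp) (φ : ℝ → Hsp → Hsp), IsNSPhase ν' (force S c) K φ ∧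
        ∃ x ∈ K, (∀ᶠ T in atTop, energyAvg φ x T ≤ E) ∧ (∃ᶠ T in atTop, ε ≤ dissipAvg ν' φ x T) ∧
          ∀ μ : Measure Hsp, IsInvariantMeasure (closure ((fun t : ℝ => φ t x) '' Ici 0)) φ μ →
            ensembleEnergy μ ≤ E → ε ≤ ensembleDissipation ν' μ → IsHyperbolicMeasure ν' (force S c) φ μ := by
  have h0 : (0 : ℝ) ∈ Ici (0 : ℝ) := mem_Ici.2 le_rfl
  have hs : IsSmooth v := hsol.smooth_velocity.isSmooth_slice h0
  have hdiv : IsDivFree v := hsol.divFree 0 h0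
  set x₀ : Hsp := ⟨(hs.memLp 2).toLp v, toLp_mem_energySpace hs hdiv hmean⟩ with hx₀
  have hrep : rep x₀ =ᵐ[volume] v := (hs.memLp 2).coeFn_toLp
  have hK : IsNSPhase ν (force S c) {x₀} (fun _ y => y) := isNSPhase_singleton_of_steady hsol hdiv hmean hs
  -- the orbit closure of `x₀` under the identity semiflow is `{x₀}`
  have horb : closure ((fun _ : ℝ => x₀) '' Ici 0) = {x₀} := by
    rw [nonempty_Ici.image_const, closure_singleton]
  -- budgets of the constant trajectory
  have hnorm : ‖x₀‖ ^ 2 = ∫ y, ‖v y‖ ^ 2 := stub_trajectoryPowerBudget_aux_norm_sq x₀ hrep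
  have hens : enstrophyObs x₀ = gradNormSq v := stub_trajectoryPowerBudget_aux_enstrophyObs_eq x₀ hs hrep
  have havgE : ∀ T : ℝ, 0 < T → energyAvg (fun _ y => y) x₀ T = ‖x₀‖ ^ 2 := fun T hT => by
    unfold energyAvg
    rw [intervalIntegral.integral_const, sub_zero, smul_eq_mul, ← mul_assoc, inv_mul_cancel₀ hT.ne', one_mul]
  have havgD : ∀ T : ℝ, 0 < T → dissipAvg ν (fun _ y => y) x₀ T = ν * enstrophyObs x₀ := fun T hT => by
    unfold dissipAvg
    rw [intervalIntegral.integral_const, sub_zero, smul_eq_mul, ← mul_assoc, inv_mul_cancel₀ hT.ne', one_mul]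
  refine ⟨ν, hν, hνj, {x₀}, fun _ y => y, hK, x₀, mem_singleton _, ?_, ?_, fun μ hμ _ _ => ?_⟩
  · filter_upwards [eventually_gt_atTop (0 : ℝ)] with T hT
    rw [havgE T hT, hnorm]
    exact hE
  · refine Filter.Eventually.frequently ?_
    filter_upwards [eventually_gt_atTop (0 : ℝ)] with T hT
    rw [havgD T hT, hens]
    exact hε
  · -- the only invariant probability measure on the orbit closure `{x₀}` is concentrated at `x₀`
    rw [horb] at hμ
    have hae : ∀ᵐ x ∂μ, x = x₀ := ae_eq_of_isInvariantMeasure_singleton hμ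
    filter_upwards [hae] with x hx
    subst hx
    intro u p hu hurep w q hw hsub
    exact hH u p hu (fun t ht => hrep.symm.trans (hurep t ht)) w q hw hsub

end SteadyEntry

end Summit.AnomalousDissipation.AnomalousDissipation.Theorems.DenseLoudDesignerForces.Ergodic

end
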